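import Summits.QuantumFields.BalabanUV.Beta.EriceRemainderEnclosureHistoryAutonomyExistence

/-!
# EriceRemainderEnclosureHistoryAutonomyMarkovInjective — (E48h) FOR MARKOV FUNCTIONALS NODE U2's ONE-STEP INJECTIVITY IS ALSO NECESSARY, ON THE REACHABLE LEVELS:
# a Markov functional `u ↦ φ(u 0)` (`φ` `M`-Lipschitz with a floor `b > 0` on ]0,γ]) has AT MOST ONE box solution from EVERY pin of ]0,γ] IF AND ONLY IF its scale function
# `ψ(a) = 1∕a² − φ(a)` takes every REACHABLE level `≥ 1∕γ²` at most once on ]0,γ] — node U2's `memFlow_unique_of_markov` (injectivity on the whole box ⟹ uniqueness) is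
# sharpened to the reachable levels and REVERSED: a level collision `ψ(a) = ψ(a′) ≥ 1∕γ²`, `a ≠ a′`, SPLICES (E39)'s solutions from `a` and `a′` behind the common pin
# `t = ψ(a)^{−1∕2}` into two distinct box solutions; so for the Markov class the uniqueness regime of (E48a)∕(E48b) is EXACTLY «`ψ` injective on the reachable range»,
# the property (E48b) EARNS for the effective β-function of any well-posed flow with memory

Cell `pub-balaban`, β-function sub-cell, BINDER row D4 «RemainderConst leaves for Bałaban's split» (`HOME/BINDER-OWNERS.md`; owner lineage `b2b-balaban-beta-an4`;
this file by co-owner #2 lineage `b2b-balaban-beta-d4-p2`, generation 45), β-FLOW TEAM duty (1), FREEZE (0) honoured (def-free; node U2's `MemFlow` ∕ `SeqBox`, (E39)'s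
`exists_memFlow_zm` BY NAME; the splice is an explicit lambda).  Companion of (E48a) `…HistoryAutonomyOrder` ∕ (E48b) `…HistoryAutonomyOrderMarkov` (NOT imported — this
file lands on long-built parents: (E39) `…HistoryAutonomyExistence` only).

HONEST FRAMING (page 1, verbatim and binding).  *"Discharging BetaPertH makes Bałaban's UV stability UNCONDITIONAL — a real constructive-QFT result; it is
NOT the continuum limit and NOT the Clay problem."*  THIS FILE DISCHARGES NOTHING OF THE KIND.  Pure real analysis about an ABSTRACT Markov functional with a displayed
Lipschitz constant and floor; Erice's as-printed `β_n(g²)` is Markov IN FORM (`BetaFlowAsPrinted`), but nothing here is asserted of it or of Bałaban's (1.22) (GAPS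
G-t4-U2-1∕-2).  Row D4 class UNCHANGED (critical-path width 0; instance 0∕1; D4 DISCHARGE NO DATE).  HONEST DEPENDENCY: continuum YM on T⁴ ⇐ BetaPertH ∧ nine spine
estimates (0/9 proved); BetaPertH ⇐ (D1) ∧ (D4) ∧ CAP+tail; G-an2-4 gates asym, D1 and NE2/3/4.

THE POINT (census sense (α); the AUTONOMY row — the Markov class exactly).  Node U2 (`T4BetaFlowWellPosed` §7): a Markov flow `1∕h_{m+1}² = 1∕h_m² + φ(h_{m+1})` has unique
box solutions as soon as `ψ(x) = 1∕x² − φ(x)` is injective on ]0,γ] — «where the smallness bites».  Two refinements, both elementary: (§2) only the levels `ψ ≥ 1∕γ²` are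
ever solved for (`1∕h_m² ≥ 1∕γ²` on the box), so injectivity ON THE REACHABLE LEVELS suffices (`unique_of_injOn_reachable`, node U2's induction verbatim); (§1) and it is
NECESSARY: if `ψ(a) = ψ(a′) = y ≥ 1∕γ²` with `a ≠ a′` in ]0,γ], then `t = y^{−1∕2} ∈ ]0,γ]` is a pin and the SPLICES `(t, u_0, u_1, …)`, `(t, u′_0, u′_1, …)` of (E39)'s box
solutions `u` from `a` and `u′` from `a′` are two DISTINCT box solutions from `t` (`splice_memFlow`, **`exists_two_solutions_of_collision`**) — the scale-0 equation
`1∕a² = 1∕t² + φ(a)` is the collision itself.  Hence (§3) **`unique_iff_injOn_reachable`**.  With (E48a)∕(E48b): for Markov functionals ORDER ⟸ uniqueness ⟺ reachable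
injectivity, and (E48b)'s `strictAntiOn_effective_scale_Ioc` shows that EVERY well-posed flow with memory, read through its effective β-function `Φ_B` (which for a
Markov `B` is `φ` itself, §3 `effective_of_markov`), lands in exactly this class.  NOT claimed: anything for non-Markov functionals beyond (E48a–g); anything printed.

WHAT IS PROVED ([folklore]; 0 `def`, 0 sorry).  §1 `splice_seqBox`, **`splice_memFlow`**, **`exists_two_solutions_of_collision`**, `not_unique_of_collision`.  §2
**`unique_of_injOn_reachable`**.  §3 **`unique_iff_injOn_reachable`**, `effective_of_markov`.
-/

noncomputable section
open Filter Topology Finset Set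

namespace Summit.QuantumFields.BalabanUV.Beta.EriceRemainderEnclosureHistoryAutonomyMarkovInjective

open Literature.MathematicalPhysics.QuantumFieldTheory.Balaban1983to89
open Literature.MathematicalPhysics.QuantumFieldTheory.Balaban1983to89.T4BetaStationary
open Literature.MathematicalPhysics.QuantumFieldTheory.Balaban1983to89.T4BetaFlowWellPosed
open Summit.QuantumFields.BalabanUV.Beta.EriceRemainderEnclosureHistoryAutonomyExistence (exists_memFlow_zm)

variable {φ : ℝ → ℝ} {M γ b : ℝ}

/-! ## §1 A level collision of the scale function splices into two box solutions from one pin -/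

/-- THE SPLICE `(t, u_0, u_1, …)` of a pin `t ∈ ]0,γ]` in front of a box history `u` is a box history. [folklore] -/
theorem splice_seqBox {t : ℝ} {u : ℕ → ℝ} (ht : 0 < t) (htγ : t ≤ γ) (hu : SeqBox γ u) :
    SeqBox γ (fun j => if j = 0 then t else u (j - 1)) := fun j => by
  cases j with
  | zero => exact ⟨by simpa using ht, by simpa using htγ⟩
  | succ j => simpa using hu j

/-- **THE SPLICE SOLVES THE MARKOV FLOW** from `t` as soon as `u` solves it from `a` and the scale-0 equation `1∕a² = 1∕t² + φ(a)` holds. [folklore] -/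
theorem splice_memFlow {t a : ℝ} {u : ℕ → ℝ} (hu : MemFlow (fun v => φ (v 0)) a u) (h0 : 1 / a ^ 2 = 1 / t ^ 2 + φ a) :
    MemFlow (fun v => φ (v 0)) t (fun j => if j = 0 then t else u (j - 1)) := by
  refine ⟨by simp, fun m => ?_⟩
  cases m with
  | zero => simpa [hu.1] using h0
  | succ m =>
      have := hu.2 m
      simp only [add_zero] at this
      simpa [Nat.add_sub_cancel] using this

/-- **A LEVEL COLLISION GIVES TWO DISTINCT BOX SOLUTIONS FROM ONE PIN**: `φ` `M`-Lipschitz with floor `b > 0` on ]0,γ]; `a ≠ a′` in ]0,γ] with `1∕a² − φ(a) = 1∕a′² − φ(a′)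
≥ 1∕γ²`.  Then from the pin `t = (1∕a² − φ(a))^{−1∕2} ∈ ]0,γ]` the Markov flow of `φ` has two distinct box solutions (splices of (E39)'s solutions from `a` and `a′`). [folklore] -/
theorem exists_two_solutions_of_collision (hb : 0 < b) (hM : 0 ≤ M)
    (hL : ∀ x x', 0 < x → x ≤ γ → 0 < x' → x' ≤ γ → |φ x - φ x'| ≤ M * |x - x'|) (hlo : ∀ x, 0 < x → x ≤ γ → b ≤ φ x)
    {a a' : ℝ} (ha : a ∈ Ioc 0 γ) (ha' : a' ∈ Ioc 0 γ) (hne : a ≠ a') (hcoll : 1 / a ^ 2 - φ a = 1 / a' ^ 2 - φ a')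
    (hreach : 1 / γ ^ 2 ≤ 1 / a ^ 2 - φ a) :
    ∃ (t : ℝ) (k k' : ℕ → ℝ), 0 < t ∧ t ≤ γ ∧ 1 / t ^ 2 = 1 / a ^ 2 - φ a ∧ SeqBox γ k ∧ SeqBox γ k' ∧
      MemFlow (fun v => φ (v 0)) t k ∧ MemFlow (fun v => φ (v 0)) t k' ∧ k 1 = a ∧ k' 1 = a' ∧ k ≠ k' := by
  have hγ : 0 < γ := ha.1.trans_le ha.2
  set y : ℝ := 1 / a ^ 2 - φ a with hy
  have hy0 : 0 < y := lt_of_lt_of_le (by positivity) hreach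
  set t : ℝ := 1 / Real.sqrt y with htdef
  have ht0 : 0 < t := by rw [htdef]; positivity
  have ht2 : 1 / t ^ 2 = y := by rw [htdef, div_pow, one_pow, Real.sq_sqrt hy0.le, one_div_one_div]
  have htγ : t ≤ γ := by
    rw [htdef]
    have h1 : 1 / γ ≤ Real.sqrt y := by
      calc 1 / γ = Real.sqrt ((1 / γ) ^ 2) := (Real.sqrt_sq (by positivity)).symm
        _ ≤ Real.sqrt y := Real.sqrt_le_sqrt (by rw [one_div_pow]; exact hreach)
    calc 1 / Real.sqrt y ≤ 1 / (1 / γ) := one_div_le_one_div_of_le (by positivity) h1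
      _ = γ := one_div_one_div γ
  -- the Markov functional has the zeroth moment `M` and the floor `b` on the box
  have hB : ∀ u u' : ℕ → ℝ, SeqBox γ u → SeqBox γ u' → ∀ D : ℝ, (∀ j, |u j - u' j| ≤ D) →
      |(fun v => φ (v 0)) u - (fun v => φ (v 0)) u'| ≤ M * D := fun u u' hu hu' D hD =>
    (hL _ _ (hu 0).1 (hu 0).2 (hu' 0).1 (hu' 0).2).trans (mul_le_mul_of_nonneg_left (hD 0) hM)
  have hloB : ∀ u, SeqBox γ u → b ≤ (fun v => φ (v 0)) u := fun u hu => hlo _ (hu 0).1 (hu 0).2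
  obtain ⟨u, hu, hfu⟩ := exists_memFlow_zm hB hM ha.1 ha.2 hb hloB
  obtain ⟨u', hu', hfu'⟩ := exists_memFlow_zm hB hM ha'.1 ha'.2 hb hloB
  have h0 : 1 / a ^ 2 = 1 / t ^ 2 + φ a := by rw [ht2, hy]; ring
  have h0' : 1 / a' ^ 2 = 1 / t ^ 2 + φ a' := by rw [ht2]; linarith [hcoll]
  refine ⟨t, fun j => if j = 0 then t else u (j - 1), fun j => if j = 0 then t else u' (j - 1), ht0, htγ, ht2,
    splice_seqBox ht0 htγ hu, splice_seqBox ht0 htγ hu', splice_memFlow hfu h0, splice_memFlow hfu' h0',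
    by simp [hfu.1], by simp [hfu'.1], fun heq => hne ?_⟩
  have := congrFun heq 1
  simpa [hfu.1, hfu'.1] using this

/-- Hence a level collision on the reachable levels REFUTES uniqueness for the Markov flow of `φ` on the box ]0,γ]. [folklore] -/
theorem not_unique_of_collision (hb : 0 < b) (hM : 0 ≤ M)
    (hL : ∀ x x', 0 < x → x ≤ γ → 0 < x' → x' ≤ γ → |φ x - φ x'| ≤ M * |x - x'|) (hlo : ∀ x, 0 < x → x ≤ γ → b ≤ φ x)
    {a a' : ℝ} (ha : a ∈ Ioc 0 γ) (ha' : a' ∈ Ioc 0 γ) (hne : a ≠ a') (hcoll : 1 / a ^ 2 - φ a = 1 / a' ^ 2 - φ a')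
    (hreach : 1 / γ ^ 2 ≤ 1 / a ^ 2 - φ a) :
    ¬ ∀ p, 0 < p → p ≤ γ → ∀ k k' : ℕ → ℝ, SeqBox γ k → SeqBox γ k' →
      MemFlow (fun v => φ (v 0)) p k → MemFlow (fun v => φ (v 0)) p k' → k = k' := by
  intro H
  obtain ⟨t, k, k', ht0, htγ, -, hk, hk', hfk, hfk', -, -, hne'⟩ :=
    exists_two_solutions_of_collision hb hM hL hlo ha ha' hne hcoll hreach
  exact hne' (H t ht0 htγ k k' hk hk' hfk hfk')

/-! ## §2 Injectivity on the reachable levels suffices (node U2's induction) -/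

/-- **UNIQUENESS FROM INJECTIVITY ON THE REACHABLE LEVELS**: if `ψ(x) = 1∕x² − φ(x)` takes every value `≥ 1∕γ²` at most once on ]0,γ], the Markov flow of `φ` has at most
one box solution from every pin of ]0,γ] — node U2's `memFlow_unique_of_markov` with the hypothesis restricted to the levels a box solution actually meets. [folklore] -/
theorem unique_of_injOn_reachable
    (hinj : ∀ x x', 0 < x → x ≤ γ → 0 < x' → x' ≤ γ → 1 / x ^ 2 - φ x = 1 / x' ^ 2 - φ x' → 1 / γ ^ 2 ≤ 1 / x ^ 2 - φ x → x = x')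
    {p : ℝ} {k k' : ℕ → ℝ} (hk : SeqBox γ k) (hk' : SeqBox γ k')
    (hf : MemFlow (fun v => φ (v 0)) p k) (hf' : MemFlow (fun v => φ (v 0)) p k') : k = k' := by
  funext m
  induction m with
  | zero => rw [hf.1, hf'.1]
  | succ m ih =>
      have e := hf.2 m
      have e' := hf'.2 m
      simp only [add_zero] at e e'
      rw [ih] at e
      have hlevel : 1 / γ ^ 2 ≤ 1 / k (m + 1) ^ 2 - φ (k (m + 1)) := by
        rw [show 1 / k (m + 1) ^ 2 - φ (k (m + 1)) = 1 / k' m ^ 2 by linarith]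
        exact one_div_le_one_div_of_le (pow_pos (hk' m).1 2) (pow_le_pow_left₀ (hk' m).1.le (hk' m).2 2)
      exact hinj _ _ (hk (m + 1)).1 (hk (m + 1)).2 (hk' (m + 1)).1 (hk' (m + 1)).2 (by linarith) hlevel

/-! ## §3 The characterisation; the effective β-function of a Markov functional -/

/-- **FOR MARKOV FUNCTIONALS, UNIQUENESS ON THE BOX ⟺ INJECTIVITY OF THE SCALE FUNCTION ON THE REACHABLE LEVELS.**  `φ` `M`-Lipschitz with floor `b > 0` on ]0,γ].
[folklore] -/
theorem unique_iff_injOn_reachable (hb : 0 < b) (hM : 0 ≤ M)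
    (hL : ∀ x x', 0 < x → x ≤ γ → 0 < x' → x' ≤ γ → |φ x - φ x'| ≤ M * |x - x'|) (hlo : ∀ x, 0 < x → x ≤ γ → b ≤ φ x) :
    (∀ p, 0 < p → p ≤ γ → ∀ k k' : ℕ → ℝ, SeqBox γ k → SeqBox γ k' →
        MemFlow (fun v => φ (v 0)) p k → MemFlow (fun v => φ (v 0)) p k' → k = k') ↔
      ∀ x x', 0 < x → x ≤ γ → 0 < x' → x' ≤ γ → 1 / x ^ 2 - φ x = 1 / x' ^ 2 - φ x' → 1 / γ ^ 2 ≤ 1 / x ^ 2 - φ x → x = x' := by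
  constructor
  · intro H x x' hx hxγ hx' hx'γ hcoll hreach
    by_contra hne
    exact not_unique_of_collision hb hM hL hlo ⟨hx, hxγ⟩ ⟨hx', hx'γ⟩ hne hcoll hreach H
  · intro hinj p _ _ k k' hk hk' hf hf'
    exact unique_of_injOn_reachable hinj hk hk' hf hf'

/-- THE EFFECTIVE β-FUNCTION OF A MARKOV FUNCTIONAL IS `φ` ITSELF: for any family `S` of histories starting at their pin (`S a 0 = a`), `B (S a) = φ a` — (E48b)'s
`Φ_B = B ∘ S` read on the Markov class. [folklore] -/
theorem effective_of_markov {S : ℝ → ℕ → ℝ} (hS0 : ∀ a, 0 < a → a ≤ γ → S a 0 = a) {a : ℝ} (ha0 : 0 < a) (haγ : a ≤ γ) :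
    (fun v : ℕ → ℝ => φ (v 0)) (S a) = φ a := by
  simp only [hS0 a ha0 haγ]

end Summit.QuantumFields.BalabanUV.Beta.EriceRemainderEnclosureHistoryAutonomyMarkovInjective

end
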